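import Summits.Ventures.CertifiedArithmetic.LowPrec.Kahan

/-!
# Kahan's compensated summation: the explicit envelope `u|ŝₙ| + (2u + 6u²)Σ|xᵢ| + 6nu²T`

HONEST FRAMING (venture CertifiedArithmetic / cell `pub-lowprec`): certified error envelopes and
provably optimal rounding/accumulation schemes for low-precision formats under stated cost models;
every table by two implementations; no hardware or vendor claims.

Second half of the Kahan development (`Kahan.lean`: the algorithm, the local rounding facts, the
exact recursion `Fₖ₊₁ = Fₖ + ηₖ + rₖ` of the compensated error). Here: the per-step bounds
`|cₖ₊₁| ≤ u(1+u)²(|xₖ₊₁| + |cₖ| + |ŝₖ₊₁|)` and `|ηₖ| + |rₖ| ≤ u(2+2u+u²)(|xₖ₊₁| + |cₖ|) +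
u²(2+u)|ŝₖ₊₁|`, their summation, and the ENVELOPE (`MiniFloat.abs_kahan_sub_sum_le`): for every
format `α` with `emaxCode ≥ 2` and `u ≤ 1/8`, summands `x₀ … xₙ ∈ F_α`, every operation in range,
and any bound `T` on the computed partial sums,

  `|ŝₙ - Σ xᵢ| ≤ u·|ŝₙ| + (2u + 6u²)·Σ|xᵢ| + 6·n·u²·T`.

First-order content `u|ŝₙ| + 2uΣ|xᵢ|` (the `3u` of [HallmanIpsen2023, Cor. 20] to first order, now
with explicit second-order constants; the literature forms are asymptotic [Higham2002ASNA, (4.9);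
BoldoEtAl2023, §5.3]). The constants `6, 6` are generous roundings at `u ≤ 1/8` of polynomial
expressions `2 + O(u)`; no sharpness is claimed for them. Instances: the hypotheses hold for
binary16/32, bfloat16, `E4M3`, `E5M2`, `E3M2`, `E2M3` (`kahan_format_hypotheses`); the bfloat16
statement is spelled out (`abs_kahan_sub_sum_le_BFloat16`).
-/

namespace Literature.ComputerArithmetic.FloatingPoint

namespace MiniFloat

open Finset

variable {α : Format}

/-! ### Per-step bounds in terms of `|xₖ₊₁|`, `|cₖ|`, `|ŝₖ₊₁|` -/

/-- `|yₖ| ≤ (1+u)(|xₖ₊₁| + |cₖ|)`. [folklore] -/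
theorem abs_kahanY_le (hα : 2 ≤ α.emaxCode) (x : ℕ → ℚ) (k : ℕ)
    (hxk : ∃ y : MiniFloat α, y.toRat = x (k + 1))
    (hr : |x (k + 1) + (kahan α x k).2| ≤ α.maxRat) :
    |kahanY α x k| ≤ (1 + α.unitRoundoff) * (|x (k + 1)| + |(kahan α x k).2|) := by
  have h := abs_kahanEta_le hα x k hxk hr
  have h1 : |x (k + 1) + (kahan α x k).2| ≤ |x (k + 1)| + |(kahan α x k).2| := abs_add_le _ _
  have h2 : |kahanY α x k| ≤ |kahanY α x k - (x (k + 1) + (kahan α x k).2)|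
      + |x (k + 1) + (kahan α x k).2| := by
    have := abs_add_le (kahanY α x k - (x (k + 1) + (kahan α x k).2)) (x (k + 1) + (kahan α x k).2)
    rwa [sub_add_cancel] at this
  have hu := α.unitRoundoff_pos
  nlinarith

/-- `|cₖ₊₁| ≤ u(1+u)²·(|xₖ₊₁| + |cₖ|) + u(1+u)²·|ŝₖ₊₁|`. [folklore] -/
theorem abs_kahan_snd_succ_le (hα : 2 ≤ α.emaxCode) (x : ℕ → ℚ) (k : ℕ)
    (hxk : ∃ y : MiniFloat α, y.toRat = x (k + 1))
    (hr1 : |x (k + 1) + (kahan α x k).2| ≤ α.maxRat)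
    (hr2 : |(kahan α x k).1 + kahanY α x k| ≤ α.maxRat)
    (hr3 : |(kahan α x k).1 - (kahan α x (k + 1)).1| ≤ α.maxRat)
    (hr4 : |flα α ((kahan α x k).1 - (kahan α x (k + 1)).1) + kahanY α x k| ≤ α.maxRat) :
    |(kahan α x (k + 1)).2|
      ≤ α.unitRoundoff * (1 + α.unitRoundoff) ^ 2 * (|x (k + 1)| + |(kahan α x k).2|)
        + α.unitRoundoff * (1 + α.unitRoundoff) ^ 2 * |(kahan α x (k + 1)).1| := by
  have hu := α.unitRoundoff_pos
  have hy := abs_kahanY_le hα x k hxk hr1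
  have he := abs_kahanE_le hα x k hr2
  have hr := abs_kahanR_le hα x k hr3 hr4
  set e := (kahan α x (k + 1)).1 - ((kahan α x k).1 + kahanY α x k)
  have h1 : |(kahan α x (k + 1)).2| ≤ |(kahan α x (k + 1)).2 + e| + |e| := by
    have := abs_sub ((kahan α x (k + 1)).2 + e) e
    rwa [add_sub_cancel_right] at this
  have h2 := mul_le_mul_of_nonneg_left hy (by positivity : 0 ≤ α.unitRoundoff * (1 + α.unitRoundoff))
  have h3 := mul_le_mul_of_nonneg_left he (by positivity : 0 ≤ α.unitRoundoff * (2 + α.unitRoundoff))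
  nlinarith [abs_nonneg e, abs_nonneg (kahanY α x k)]

/-- `|ηₖ| + |rₖ| ≤ u(2 + 2u + u²)·(|xₖ₊₁| + |cₖ|) + u²(2+u)·|ŝₖ₊₁|`. [folklore] -/
theorem abs_kahanEta_add_abs_kahanR_le (hα : 2 ≤ α.emaxCode) (x : ℕ → ℚ) (k : ℕ)
    (hxk : ∃ y : MiniFloat α, y.toRat = x (k + 1))
    (hr1 : |x (k + 1) + (kahan α x k).2| ≤ α.maxRat)
    (hr2 : |(kahan α x k).1 + kahanY α x k| ≤ α.maxRat)
    (hr3 : |(kahan α x k).1 - (kahan α x (k + 1)).1| ≤ α.maxRat)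
    (hr4 : |flα α ((kahan α x k).1 - (kahan α x (k + 1)).1) + kahanY α x k| ≤ α.maxRat) :
    |kahanY α x k - (x (k + 1) + (kahan α x k).2)|
      + |(kahan α x (k + 1)).2 + ((kahan α x (k + 1)).1 - ((kahan α x k).1 + kahanY α x k))|
      ≤ α.unitRoundoff * (2 + 2 * α.unitRoundoff + α.unitRoundoff ^ 2)
          * (|x (k + 1)| + |(kahan α x k).2|)
        + α.unitRoundoff ^ 2 * (2 + α.unitRoundoff) * |(kahan α x (k + 1)).1| := by
  have hu := α.unitRoundoff_pos
  have hη := abs_kahanEta_le hα x k hxk hr1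
  have hy := abs_kahanY_le hα x k hxk hr1
  have he := abs_kahanE_le hα x k hr2
  have hr := abs_kahanR_le hα x k hr3 hr4
  have h1 : |x (k + 1) + (kahan α x k).2| ≤ |x (k + 1)| + |(kahan α x k).2| := abs_add_le _ _
  have h2 := mul_le_mul_of_nonneg_left hy (by positivity : 0 ≤ α.unitRoundoff * (1 + α.unitRoundoff))
  have h3 := mul_le_mul_of_nonneg_left he (by positivity : 0 ≤ α.unitRoundoff * (2 + α.unitRoundoff))
  have h4 := mul_le_mul_of_nonneg_left h1 hu.le
  nlinarith

/-! ### The compensated error is the sum of the local terms -/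

/-- `|Fₘ| ≤ Σ_{k<m} (|ηₖ| + |rₖ|)` for `x₀ ∈ F_α` (no range hypothesis: identities only). [folklore] -/
theorem abs_kahanF_le (x : ℕ → ℚ) (hx0 : ∃ y : MiniFloat α, y.toRat = x 0) :
    ∀ m, |kahanF α x m| ≤ ∑ k ∈ range m,
      (|kahanY α x k - (x (k + 1) + (kahan α x k).2)|
        + |(kahan α x (k + 1)).2 + ((kahan α x (k + 1)).1 - ((kahan α x k).1 + kahanY α x k))|)
  | 0 => by rw [kahanF_zero x hx0]; simp
  | m + 1 => by
      rw [kahanF_succ, sum_range_succ]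
      have ih := abs_kahanF_le x hx0 m
      calc _ ≤ |kahanF α x m + (kahanY α x m - (x (m + 1) + (kahan α x m).2))|
            + |(kahan α x (m + 1)).2 + ((kahan α x (m + 1)).1 - ((kahan α x m).1 + kahanY α x m))| :=
            abs_add_le _ _
        _ ≤ |kahanF α x m| + |kahanY α x m - (x (m + 1) + (kahan α x m).2)|
            + |(kahan α x (m + 1)).2 + ((kahan α x (m + 1)).1 - ((kahan α x m).1 + kahanY α x m))| :=
            by gcongr; exact abs_add_le _ _
        _ ≤ _ := by linarith

/-! ### The envelope -/

/-- SUM OF THE LOCAL TERMS: under the hypotheses of the envelope theorem,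
`Σ_{k<n} (|ηₖ| + |rₖ|) ≤ (2u + 6u²)·Σ|xᵢ| + 6·n·u²·T`. [folklore] -/
theorem sum_kahanLocal_le (hα : 2 ≤ α.emaxCode) (hu8 : α.unitRoundoff ≤ 1 / 8) (x : ℕ → ℚ)
    (n : ℕ) (hx : ∀ i ≤ n, ∃ y : MiniFloat α, y.toRat = x i)
    (hr : ∀ k < n, |x (k + 1) + (kahan α x k).2| ≤ α.maxRat ∧
      |(kahan α x k).1 + kahanY α x k| ≤ α.maxRat ∧
      |(kahan α x k).1 - (kahan α x (k + 1)).1| ≤ α.maxRat ∧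
      |flα α ((kahan α x k).1 - (kahan α x (k + 1)).1) + kahanY α x k| ≤ α.maxRat)
    {T : ℚ} (hT : ∀ k ≤ n, |(kahan α x k).1| ≤ T) :
    ∑ k ∈ range n, (|kahanY α x k - (x (k + 1) + (kahan α x k).2)|
        + |(kahan α x (k + 1)).2 + ((kahan α x (k + 1)).1 - ((kahan α x k).1 + kahanY α x k))|)
      ≤ (2 * α.unitRoundoff + 6 * α.unitRoundoff ^ 2) * ∑ i ∈ range (n + 1), |x i|
        + 6 * n * α.unitRoundoff ^ 2 * T := by
  have hu := α.unitRoundoff_pos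
  set u := α.unitRoundoff with hu_def
  have hT0 : 0 ≤ T := le_trans (abs_nonneg _) (hT 0 (Nat.zero_le _))
  set S := ∑ i ∈ range (n + 1), |x i| with hS_def
  have hS0 : 0 ≤ S := sum_nonneg (fun i _ => abs_nonneg (x i))
  set C := ∑ k ∈ range n, |(kahan α x k).2| with hC_def
  have hC0 : 0 ≤ C := sum_nonneg (fun i _ => abs_nonneg _)
  have hxs : ∑ k ∈ range n, |x (k + 1)| ≤ S := by
    rw [hS_def, sum_range_succ' (fun i => |x i|)]
    linarith [abs_nonneg (x 0)]
  -- (b) Φ ≤ u(2+2u+u²)(S + C) + n u²(2+u) T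
  have hΦ : ∑ k ∈ range n, (|kahanY α x k - (x (k + 1) + (kahan α x k).2)|
        + |(kahan α x (k + 1)).2 + ((kahan α x (k + 1)).1 - ((kahan α x k).1 + kahanY α x k))|)
      ≤ u * (2 + 2 * u + u ^ 2) * (S + C) + (n : ℕ) * (u ^ 2 * (2 + u) * T) := by
    have hpt : ∀ k ∈ range n, (|kahanY α x k - (x (k + 1) + (kahan α x k).2)|
        + |(kahan α x (k + 1)).2 + ((kahan α x (k + 1)).1 - ((kahan α x k).1 + kahanY α x k))|)
        ≤ u * (2 + 2 * u + u ^ 2) * (|x (k + 1)| + |(kahan α x k).2|) + u ^ 2 * (2 + u) * T := by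
      intro k hk
      rw [mem_range] at hk
      obtain ⟨h1, h2, h3, h4⟩ := hr k hk
      have := abs_kahanEta_add_abs_kahanR_le hα x k (hx (k + 1) (by omega)) h1 h2 h3 h4
      have hTk := hT (k + 1) (by omega)
      have : u ^ 2 * (2 + u) * |(kahan α x (k + 1)).1| ≤ u ^ 2 * (2 + u) * T :=
        mul_le_mul_of_nonneg_left hTk (by positivity)
      linarith
    have hsum := sum_le_sum hpt
    have hrhs : ∑ k ∈ range n, (u * (2 + 2 * u + u ^ 2) * (|x (k + 1)| + |(kahan α x k).2|)
        + u ^ 2 * (2 + u) * T)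
        = u * (2 + 2 * u + u ^ 2) * ((∑ k ∈ range n, |x (k + 1)|) + C)
          + (n : ℕ) * (u ^ 2 * (2 + u) * T) := by
      rw [sum_add_distrib, sum_const, card_range, ← mul_sum, sum_add_distrib, nsmul_eq_mul]
    rw [hrhs] at hsum
    have hpos : 0 ≤ u * (2 + 2 * u + u ^ 2) := by positivity
    nlinarith [hsum, hxs, hpos]
  -- (c) C ≤ γ (S + C) + n γ T with γ = u(1+u)²
  have hC : C ≤ u * (1 + u) ^ 2 * (S + C) + (n : ℕ) * (u * (1 + u) ^ 2 * T) := by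
    have hpt : ∀ k ∈ range n, |(kahan α x (k + 1)).2|
        ≤ u * (1 + u) ^ 2 * (|x (k + 1)| + |(kahan α x k).2|) + u * (1 + u) ^ 2 * T := by
      intro k hk
      rw [mem_range] at hk
      obtain ⟨h1, h2, h3, h4⟩ := hr k hk
      have := abs_kahan_snd_succ_le hα x k (hx (k + 1) (by omega)) h1 h2 h3 h4
      have hTk := hT (k + 1) (by omega)
      have : u * (1 + u) ^ 2 * |(kahan α x (k + 1)).1| ≤ u * (1 + u) ^ 2 * T :=
        mul_le_mul_of_nonneg_left hTk (by positivity)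
      linarith
    have hsum := sum_le_sum hpt
    have hrhs : ∑ k ∈ range n, (u * (1 + u) ^ 2 * (|x (k + 1)| + |(kahan α x k).2|)
        + u * (1 + u) ^ 2 * T)
        = u * (1 + u) ^ 2 * ((∑ k ∈ range n, |x (k + 1)|) + C)
          + (n : ℕ) * (u * (1 + u) ^ 2 * T) := by
      rw [sum_add_distrib, sum_const, card_range, ← mul_sum, sum_add_distrib, nsmul_eq_mul]
    rw [hrhs] at hsum
    -- C ≤ Σ |c_{k+1}| (shift, c₀ = 0)
    have hshift : C ≤ ∑ k ∈ range n, |(kahan α x (k + 1)).2| := by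
      rcases Nat.eq_zero_or_pos n with hn0 | hnpos
      · subst hn0; simp [hC_def]
      · obtain ⟨m, rfl⟩ : ∃ m, n = m + 1 := ⟨n - 1, by omega⟩
        rw [hC_def, sum_range_succ' (fun k => |(kahan α x k).2|), kahan_zero_snd, abs_zero,
          add_zero, sum_range_succ (fun k => |(kahan α x (k + 1)).2|)]
        linarith [abs_nonneg ((kahan α x (m + 1)).2)]
    have hpos : 0 ≤ u * (1 + u) ^ 2 := by positivity
    nlinarith [hsum, hxs, hshift, hpos]
  -- (d) numerics at u ≤ 1/8
  have hγ : u * (1 + u) ^ 2 ≤ 1 / 6 := by nlinarith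
  have hC' : C ≤ 6 / 5 * (u * (1 + u) ^ 2) * (S + (n : ℕ) * T) := by
    have h1 : u * (1 + u) ^ 2 * C ≤ C / 6 := by nlinarith
    nlinarith
  have hnT : (0 : ℚ) ≤ (n : ℕ) * T := by positivity
  have h1 : (1 + u) ^ 2 ≤ 81 / 64 := by nlinarith
  have h2 : 2 + 2 * u + u ^ 2 ≤ 145 / 64 := by nlinarith
  have h3 : u * (2 + 2 * u + u ^ 2) * C
      ≤ u * (145 / 64) * (6 / 5 * (u * (81 / 64)) * (S + (n : ℕ) * T)) := by
    calc u * (2 + 2 * u + u ^ 2) * C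
        ≤ u * (145 / 64) * C := by
          apply mul_le_mul_of_nonneg_right _ hC0; exact mul_le_mul_of_nonneg_left h2 hu.le
      _ ≤ u * (145 / 64) * (6 / 5 * (u * (1 + u) ^ 2) * (S + (n : ℕ) * T)) :=
          mul_le_mul_of_nonneg_left hC' (by positivity)
      _ ≤ u * (145 / 64) * (6 / 5 * (u * (81 / 64)) * (S + (n : ℕ) * T)) := by
          apply mul_le_mul_of_nonneg_left _ (by positivity)
          apply mul_le_mul_of_nonneg_right _ (by positivity)
          apply mul_le_mul_of_nonneg_left _ (by norm_num)
          exact mul_le_mul_of_nonneg_left h1 hu.le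
  have h4 : u * (2 + 2 * u + u ^ 2) * S = 2 * u * S + u ^ 2 * (2 + u) * S := by ring
  have h5 : u ^ 2 * (2 + u) ≤ u ^ 2 * (17 / 8) := mul_le_mul_of_nonneg_left (by linarith) (by positivity)
  nlinarith [hΦ, h3, h4, h5, mul_nonneg (mul_nonneg hu.le hu.le) hS0,
    mul_nonneg (mul_nonneg hu.le hu.le) hnT]

/-- KAHAN, THE COMPENSATED PAIR: `|ŝₙ + cₙ - Σᵢ xᵢ| ≤ (2u + 6u²)·Σ|xᵢ| + 6·n·u²·T` — first order
`2u·Σ|xᵢ|`, the classical constant for the sum WITH the final correction [Higham2002ASNA, (4.9);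
HallmanIpsen2023 Rem. 21], here with explicit second-order terms (hypotheses as in
`abs_kahan_sub_sum_le`). [cite: Higham2002ASNA, Alg. 4.2 and (4.9)] -/
theorem abs_kahan_pair_sub_sum_le (hα : 2 ≤ α.emaxCode) (hu8 : α.unitRoundoff ≤ 1 / 8)
    (x : ℕ → ℚ) (n : ℕ) (hx : ∀ i ≤ n, ∃ y : MiniFloat α, y.toRat = x i)
    (hr : ∀ k < n, |x (k + 1) + (kahan α x k).2| ≤ α.maxRat ∧
      |(kahan α x k).1 + kahanY α x k| ≤ α.maxRat ∧
      |(kahan α x k).1 - (kahan α x (k + 1)).1| ≤ α.maxRat ∧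
      |flα α ((kahan α x k).1 - (kahan α x (k + 1)).1) + kahanY α x k| ≤ α.maxRat)
    {T : ℚ} (hT : ∀ k ≤ n, |(kahan α x k).1| ≤ T) :
    |(kahan α x n).1 + (kahan α x n).2 - ∑ i ∈ range (n + 1), x i|
      ≤ (2 * α.unitRoundoff + 6 * α.unitRoundoff ^ 2) * ∑ i ∈ range (n + 1), |x i|
        + 6 * n * α.unitRoundoff ^ 2 * T :=
  le_trans (abs_kahanF_le x (hx 0 (Nat.zero_le _)) n) (sum_kahanLocal_le hα hu8 x n hx hr hT)

/-- KAHAN SUMMATION (RETURNED `ŝ`), EXPLICIT ENVELOPE: format `α` with `emaxCode ≥ 2` and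
`u ≤ 1/8`; summands `x₀, …, xₙ ∈ F_α` (`n` compensated steps); every operation in range (the four
sums formed in each step have magnitude `≤ maxRat`); `T` any bound on the computed partial sums
`|ŝₖ|`, `k ≤ n`. Then `|ŝₙ - Σᵢ xᵢ| ≤ u|ŝₙ| + (2u + 6u²)·Σᵢ|xᵢ| + 6·n·u²·T` (first order
`u|ŝₙ| + 2uΣ|xᵢ| ≤ 3u·Σ|xᵢ|`). [cite: Higham2002ASNA, Alg. 4.2 and (4.9)] -/
theorem abs_kahan_sub_sum_le (hα : 2 ≤ α.emaxCode) (hu8 : α.unitRoundoff ≤ 1 / 8) (x : ℕ → ℚ)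
    (n : ℕ) (hx : ∀ i ≤ n, ∃ y : MiniFloat α, y.toRat = x i)
    (hr : ∀ k < n, |x (k + 1) + (kahan α x k).2| ≤ α.maxRat ∧
      |(kahan α x k).1 + kahanY α x k| ≤ α.maxRat ∧
      |(kahan α x k).1 - (kahan α x (k + 1)).1| ≤ α.maxRat ∧
      |flα α ((kahan α x k).1 - (kahan α x (k + 1)).1) + kahanY α x k| ≤ α.maxRat)
    {T : ℚ} (hT : ∀ k ≤ n, |(kahan α x k).1| ≤ T) :
    |(kahan α x n).1 - ∑ i ∈ range (n + 1), x i|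
      ≤ α.unitRoundoff * |(kahan α x n).1|
        + (2 * α.unitRoundoff + 6 * α.unitRoundoff ^ 2) * ∑ i ∈ range (n + 1), |x i|
        + 6 * n * α.unitRoundoff ^ 2 * T := by
  have hu := α.unitRoundoff_pos
  have hT0 : 0 ≤ T := le_trans (abs_nonneg _) (hT 0 (Nat.zero_le _))
  have hS0 : 0 ≤ ∑ i ∈ range (n + 1), |x i| := sum_nonneg (fun i _ => abs_nonneg (x i))
  rcases Nat.eq_zero_or_pos n with hn0 | hnpos
  · subst hn0
    have h0 : (kahan α x 0).1 = x 0 := by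
      rw [kahan_zero_fst]; unfold flα; exact toRat_roundNE_of_exists (hx 0 le_rfl)
    have hs : ∑ i ∈ range (0 + 1), x i = x 0 := by simp
    have hs' : ∑ i ∈ range (0 + 1), |x i| = |x 0| := by simp
    rw [hs, hs', h0, sub_self, abs_zero]
    have h1 : 0 ≤ α.unitRoundoff * |x 0| := mul_nonneg hu.le (abs_nonneg _)
    have h2 : 0 ≤ (2 * α.unitRoundoff + 6 * α.unitRoundoff ^ 2) * |x 0| :=
      mul_nonneg (by positivity) (abs_nonneg _)
    have hz : (6 : ℚ) * ((0 : ℕ) : ℚ) * α.unitRoundoff ^ 2 * T = 0 := by simp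
    linarith
  obtain ⟨m, rfl⟩ : ∃ m, n = m + 1 := ⟨n - 1, by omega⟩
  have hloc := sum_kahanLocal_le hα hu8 x (m + 1) hx hr hT
  -- |E| ≤ Φ + u |ŝ|
  rw [kahan_fst_sub_sum]
  have hF := abs_kahanF_le (α := α) x (hx 0 (Nat.zero_le _)) m
  have he := abs_kahanE_le hα x m (hr m (by omega)).2.1
  have hsplit := sum_range_succ (fun k => |kahanY α x k - (x (k + 1) + (kahan α x k).2)|
      + |(kahan α x (k + 1)).2 + ((kahan α x (k + 1)).1 - ((kahan α x k).1 + kahanY α x k))|) m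
  calc |kahanF α x m + (kahanY α x m - (x (m + 1) + (kahan α x m).2))
        + ((kahan α x (m + 1)).1 - ((kahan α x m).1 + kahanY α x m))|
      ≤ |kahanF α x m + (kahanY α x m - (x (m + 1) + (kahan α x m).2))|
          + |(kahan α x (m + 1)).1 - ((kahan α x m).1 + kahanY α x m)| := abs_add_le _ _
    _ ≤ |kahanF α x m| + |kahanY α x m - (x (m + 1) + (kahan α x m).2)|
          + |(kahan α x (m + 1)).1 - ((kahan α x m).1 + kahanY α x m)| := by
          gcongr; exact abs_add_le _ _
    _ ≤ _ := by
          linarith [abs_nonneg ((kahan α x (m + 1)).2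
            + ((kahan α x (m + 1)).1 - ((kahan α x m).1 + kahanY α x m)))]

/-- The hypotheses `emaxCode ≥ 2`, `u ≤ 1/8` hold for the cell's accumulator formats binary16,
bfloat16, binary32 and for OCP `E4M3`, `E5M2`, `E3M2`, `E2M3` (not for `E2M1`, `u = 1/4`).
[folklore] -/
theorem kahan_format_hypotheses :
    (2 ≤ Format.Binary16.emaxCode ∧ Format.Binary16.unitRoundoff ≤ 1 / 8) ∧
    (2 ≤ Format.BFloat16.emaxCode ∧ Format.BFloat16.unitRoundoff ≤ 1 / 8) ∧
    (2 ≤ Format.Binary32.emaxCode ∧ Format.Binary32.unitRoundoff ≤ 1 / 8) ∧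
    (2 ≤ Format.E4M3.emaxCode ∧ Format.E4M3.unitRoundoff ≤ 1 / 8) ∧
    (2 ≤ Format.E5M2.emaxCode ∧ Format.E5M2.unitRoundoff ≤ 1 / 8) ∧
    (2 ≤ Format.E3M2.emaxCode ∧ Format.E3M2.unitRoundoff ≤ 1 / 8) ∧
    (2 ≤ Format.E2M3.emaxCode ∧ Format.E2M3.unitRoundoff ≤ 1 / 8) ∧
    ¬ Format.E2M1.unitRoundoff ≤ 1 / 8 := by
  decide +kernel

/-- KAHAN IN `bfloat16` (statement specialised; `u = 2^-8`): `|ŝₙ - Σxᵢ| ≤ 2^-8|ŝₙ| +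
(2^-7 + 6·2^-16)Σ|xᵢ| + 6n·2^-16·T`. [cite: Higham2002ASNA, Alg. 4.2] -/
theorem abs_kahan_sub_sum_le_BFloat16 (x : ℕ → ℚ) (n : ℕ)
    (hx : ∀ i ≤ n, ∃ y : MiniFloat Format.BFloat16, y.toRat = x i)
    (hr : ∀ k < n, |x (k + 1) + (kahan Format.BFloat16 x k).2| ≤ Format.BFloat16.maxRat ∧
      |(kahan Format.BFloat16 x k).1 + kahanY Format.BFloat16 x k| ≤ Format.BFloat16.maxRat ∧
      |(kahan Format.BFloat16 x k).1 - (kahan Format.BFloat16 x (k + 1)).1|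
        ≤ Format.BFloat16.maxRat ∧
      |flα Format.BFloat16 ((kahan Format.BFloat16 x k).1 - (kahan Format.BFloat16 x (k + 1)).1)
        + kahanY Format.BFloat16 x k| ≤ Format.BFloat16.maxRat)
    {T : ℚ} (hT : ∀ k ≤ n, |(kahan Format.BFloat16 x k).1| ≤ T) :
    |(kahan Format.BFloat16 x n).1 - ∑ i ∈ range (n + 1), x i|
      ≤ 1 / 2 ^ 8 * |(kahan Format.BFloat16 x n).1|
        + (2 * (1 / 2 ^ 8) + 6 * (1 / 2 ^ 8) ^ 2) * ∑ i ∈ range (n + 1), |x i|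
        + 6 * n * (1 / 2 ^ 8) ^ 2 * T := by
  have h := abs_kahan_sub_sum_le (by decide) (kahan_format_hypotheses.2.1.2) x n hx hr hT
  rwa [Format.unitRoundoff_values.2.2.2.2.2.2.1] at h

/-- KAHAN INNER PRODUCT WITH EXACT PRODUCTS (the cell's GEMM model: products of two low-precision
formats delivered exactly in the accumulator `α`, `Exact.lean`): the same envelope for
`Σ aᵢbᵢ`, parametric in the exactness hypothesis. [cite: Higham2002ASNA, Alg. 4.2] -/
theorem abs_kahan_dot_sub_le {φ₁ φ₂ : Format} (hα : 2 ≤ α.emaxCode) (hu8 : α.unitRoundoff ≤ 1 / 8)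
    (hexact : ∀ (a : MiniFloat φ₁) (b : MiniFloat φ₂), ∃ z : MiniFloat α, z.toRat = a.toRat * b.toRat)
    (a : ℕ → MiniFloat φ₁) (b : ℕ → MiniFloat φ₂) (n : ℕ)
    (hr : ∀ k < n,
      |(a (k + 1)).toRat * (b (k + 1)).toRat
          + (kahan α (fun i => (a i).toRat * (b i).toRat) k).2| ≤ α.maxRat ∧
      |(kahan α (fun i => (a i).toRat * (b i).toRat) k).1
          + kahanY α (fun i => (a i).toRat * (b i).toRat) k| ≤ α.maxRat ∧
      |(kahan α (fun i => (a i).toRat * (b i).toRat) k).1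
          - (kahan α (fun i => (a i).toRat * (b i).toRat) (k + 1)).1| ≤ α.maxRat ∧
      |flα α ((kahan α (fun i => (a i).toRat * (b i).toRat) k).1
          - (kahan α (fun i => (a i).toRat * (b i).toRat) (k + 1)).1)
          + kahanY α (fun i => (a i).toRat * (b i).toRat) k| ≤ α.maxRat)
    {T : ℚ} (hT : ∀ k ≤ n, |(kahan α (fun i => (a i).toRat * (b i).toRat) k).1| ≤ T) :
    |(kahan α (fun i => (a i).toRat * (b i).toRat) n).1
        - ∑ i ∈ range (n + 1), (a i).toRat * (b i).toRat|
      ≤ α.unitRoundoff * |(kahan α (fun i => (a i).toRat * (b i).toRat) n).1|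
        + (2 * α.unitRoundoff + 6 * α.unitRoundoff ^ 2)
          * ∑ i ∈ range (n + 1), |(a i).toRat * (b i).toRat|
        + 6 * n * α.unitRoundoff ^ 2 * T :=
  abs_kahan_sub_sum_le hα hu8 _ n (fun i _ => hexact (a i) (b i)) hr hT

/-! ### Kernel replays -/

/-- The GEMM note's certified `kahan` rows (products of `E2M1` values accumulated in `bfloat16`,
Table S5, two implementations): witnesses `(¼, -36, -36)` ↦ `ŝ = -72` (exact `-71.75`, ratio
`1/289 = W_kahan(3)`) and `(¼, 4, 24, 36)` ↦ `ŝ = 64` with final `c = ¼` (exact `64.25`, ratio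
`1/257 = W_kahan(4)`; here `ŝ + c` is exact and the whole error is the dropped correction) — the
Lean definition of `kahan` reproduces both rows (a further implementation agreeing on them).
[folklore] -/
theorem kahan_gemm_witnesses_BFloat16 :
    (kahan Format.BFloat16 (fun i => if i = 0 then 1 / 4 else -36) 2).1 = -72 ∧
    (kahan Format.BFloat16 (fun i => [1 / 4, 4, 24, 36].getD i 0) 3).1 = 64 ∧
    (kahan Format.BFloat16 (fun i => [1 / 4, 4, 24, 36].getD i 0) 3).2 = 1 / 4 := by
  decide +kernel

/-- The Lange–Rump data `1, u, u, u, u` in `bfloat16` (`u = 2^-8`), on which recursive summation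
never leaves `1`: Kahan's loop returns the EXACT sum `1 + 1/64` after four `u`'s, and after three
`u`'s returns `ŝ = 1 + 1/64` with `c = -u`, so that `ŝ + c = 1 + 3u` is exact. [folklore] -/
theorem kahan_BFloat16_LangeRump_witness :
    (kahan Format.BFloat16 (fun i => if i = 0 then 1 else 1 / 256) 4).1 = 1 + 1 / 64 ∧
    (kahan Format.BFloat16 (fun i => if i = 0 then 1 else 1 / 256) 3).1 = 1 + 1 / 64 ∧
    (kahan Format.BFloat16 (fun i => if i = 0 then 1 else 1 / 256) 3).2 = -(1 / 256) := by
  decide +kernel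

end MiniFloat

end Literature.ComputerArithmetic.FloatingPoint
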